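import Summits.BirchSwinnertonDyer.BirchSwinnertonDyer.Theorems.SemiOrdinaryEisensteinDescentShaTwoCochainPairChoiceIndependence
import Summits.BirchSwinnertonDyer.BirchSwinnertonDyer.Theorems.SemiOrdinaryEisensteinDescentShaTwoCochainLocalCurrency
import Summits.BirchSwinnertonDyer.BirchSwinnertonDyer.Theorems.SemiOrdinaryEisensteinDescentShaTwoCochainBridgeDataPlace
import HarnessLib

/-!
# The Ш²-cochain bridge, LOCAL JOIN at a place: the `K̄_vˣ`-valued local cocycle `π_v Z|_{Γ_v}` of a continuous idèle `2`-cocycle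
# `Z` (exists, class depends only on `[Z]`), and — at a finite place — its Brauer invariant equals `(1/n)·inv_v` of the
# `μₙ`-currency local term of any admissible choice whose `ι_v ∘ κ`-image is `π_v Z − dλ_v` (steps (P)+(D) of SHA2-BRIDGE-w3g7 joined)

Route `SemiOrdinaryEisensteinDescent` (BSD), Kolyvagin column, Cassels–Tate lane: print item `CasselsTateLevelInputsFact`
(stmt-BirchSwinnertonDyer-20191), binder `hbridge` of `ShaTwoCochainTheta.casselsTate_levelInputs_of_readout_vanishing` (p638776).
This file is the per-place JOIN between
* the bridge's `μₙ`-currency package `…BridgePackageMu` (p641526), conjunct (6♭): at `v`, for the evaluation pairing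
  `P = (tateDualPairing ρ n).flip` restricted along `θ_v`, an admissible raw choice `(H♭; φ♭_v)` in the format of
  `…PairChoiceIndependence` (S1′, p635677; glue-L p640244) and `λ_v` with `ι_v (κ (φ♭_v ∪ γ − H♭)(σ',τ')) = π_v Z(θσ',θτ') − dλ_v(σ',τ')`;
* step S3 (`…IdeleDescent`, p-landed by w2 g11: `brauerInvariantEquiv_twoCocycleClass_eq_localInv` reads the Brauer invariant of ANY
  continuous `K̄_vˣ`-valued `2`-cocycle `c` with `c(s,t) = π_v Z'(res s, res t)`), which needs `π_v Z|_{Γ_v}` as a COCYCLE and its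
  class to depend only on `[Z]`;
* the dictionary (D) `…LocalCurrency` (p640894).

* **`exists_localProjectionCocycle`** — for every continuous `2`-cocycle `Z` of `J̄ = LCarrier (ideleBarD K)`, place `v` and idèle
  projection `π_v`, a continuous `2`-cocycle `c_Z` of `Γ_{K_v}` in `K̄_vˣ` with `c_Z(s,t) = π_v Z(θs, θt)`.
* **`twoCocycleClass_localProjection_congr`** — `[Z₁] = [Z₂] ⟹ [c_{Z₁}] = [c_{Z₂}]`.
* **`brauerInvariantEquiv_localProjection_eq_zmodToQmodZ_canonical`** — at a finite place: `inv_{K_v} [c_Z] =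
  zmodToQmodZ n (canonical K n v [φ♭_v ∪ γ|_v − H♭|_v])` (the S1′-format local term), whenever
  `ι_v (κ ((φ♭_v ∪ γ − H♭)(σ',τ'))) = π_v Z(θσ',θτ') − dλ_v(σ',τ')`.

Width seat `bsd-wall-soed-p2-w3` g7; `--supports stmt-BirchSwinnertonDyer-20480`, helper.  THEOREMS ONLY; no case of BSD,
Poitou–Tate or Cassels–Tate is proved here.

## References
* [MilneADT2006] J. S. Milne, *Arithmetic Duality Theorems*, 2nd ed. (2006), I §1, Lemma 4.13, Thm. 4.10 (a) (proof, p. 58).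
* [CasselsFrohlichANT1967] J. W. S. Cassels, A. Fröhlich (eds.), *Algebraic Number Theory* (1967), Ch. VII §7.3 Cor. 7.4 (b), §11.2.
* [SerreGaloisCohomology1997] J.-P. Serre, *Galois Cohomology* (1997), I §2.2–2.3.
-/

noncomputable section

-- `Summit.<P>.<Sub>` repeats `BirchSwinnertonDyer` by the tree's layout convention (D-0017)
set_option linter.dupNamespace false
set_option autoImplicit false

namespace Summit.BirchSwinnertonDyer.BirchSwinnertonDyer.Theorems.ShaTwoCochain

open CategoryTheory NumberField IsDedekindDomain Function Field
open Literature.NumberTheory.EllipticCurves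
open Literature.NumberTheory.GaloisRepresentations Literature.NumberTheory.GaloisRepresentations.HomDual
  Literature.NumberTheory.GaloisCohomology
open Literature.Algebra.Homology Literature.Algebra.Homology.DiscreteRep ContRepresentation Literature
open Literature.NumberTheory.GaloisRepresentations.DiscreteGaloisModule (units UnitsCarrier mu MuCarrier TateDual tateDual
  tateDualPairing)
open Literature.NumberTheory.GaloisRepresentations.DGMBridge
open Literature.AnabelianGeometry.AbsoluteAnabelian (Prop121vii.brauerInvariantEquiv Prop121vii.zmodToQmodZ)
open scoped ContRepresentation NumberField

variable {K : Type} [Field K] [NumberField K]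

/-! ## §1 The local cocycle `π_v Z|_{Γ_v}` -/

/-- **`π_v Z|_{Γ_v}` exists as a continuous `2`-cocycle of `Γ_{K_v}` in `K̄_vˣ`**, with values `π_v Z(θs, θt)` (`π_v` additive and
`θ_v`-equivariant on `LCarrier (ideleBarD K)`, `ideleProjection_toDGM_smul`). [cite: MilneADT2006, I Lemma 4.13 (proof)] -/
theorem exists_localProjectionCocycle (Z : contTwoCocycles (toDGM (ideleBarD K)).toTopRep) (v : Place K)
    (π : HomDual.IdeleProjection K v) :
    ∃ cZ : contTwoCocycles (units (Place.Completion v)).toTopRep, ∀ s t : absoluteGaloisGroup (Place.Completion v),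
      cZ.1 (s, t) = (π.toAddMonoidHom.comp (LCarrier.val (ideleBarD K)))
        (Z.1 (absGaloisRestrict K (Place.Completion v) s, absGaloisRestrict K (Place.Completion v) t)) := by
  have hπ := ideleProjection_toDGM_smul π
  refine ⟨⟨⟨fun st => (π.toAddMonoidHom.comp (LCarrier.val (ideleBarD K)))
      (Z.1 (absGaloisRestrict K (Place.Completion v) st.1, absGaloisRestrict K (Place.Completion v) st.2)), ?_⟩, ?_⟩,
    fun s t => rfl⟩
  · exact (continuous_of_discreteTopology (f := fun j : LCarrier (ideleBarD K) =>
        (π.toAddMonoidHom.comp (LCarrier.val (ideleBarD K))) j)).comp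
      (Z.1.continuous.comp ((((absGaloisRestrict K (Place.Completion v)).continuous.comp continuous_fst).prodMk
        ((absGaloisRestrict K (Place.Completion v)).continuous.comp continuous_snd))))
  · rw [mem_contTwoCocycles_iff]
    intro s t u
    have hZ := (mem_contTwoCocycles_iff _).1 Z.2 (absGaloisRestrict K (Place.Completion v) s)
      (absGaloisRestrict K (Place.Completion v) t) (absGaloisRestrict K (Place.Completion v) u)
    change units (Place.Completion v) s ((π.toAddMonoidHom.comp (LCarrier.val (ideleBarD K)))
        (Z.1 (absGaloisRestrict K (Place.Completion v) t, absGaloisRestrict K (Place.Completion v) u))) +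
      (π.toAddMonoidHom.comp (LCarrier.val (ideleBarD K)))
        (Z.1 (absGaloisRestrict K (Place.Completion v) s, absGaloisRestrict K (Place.Completion v) (t * u))) =
      (π.toAddMonoidHom.comp (LCarrier.val (ideleBarD K)))
        (Z.1 (absGaloisRestrict K (Place.Completion v) (s * t), absGaloisRestrict K (Place.Completion v) u)) +
      (π.toAddMonoidHom.comp (LCarrier.val (ideleBarD K)))
        (Z.1 (absGaloisRestrict K (Place.Completion v) s, absGaloisRestrict K (Place.Completion v) t))
    rw [← hπ, map_mul, map_mul, ← map_add, ← map_add]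
    exact congrArg (π.toAddMonoidHom.comp (LCarrier.val (ideleBarD K))) hZ

/-- **The class of `π_v Z|_{Γ_v}` depends only on `[Z]`**: cohomologous idèle cocycles have cohomologous local projections
(`Z₁ − Z₂ = dW ⟹ c₁ − c₂ = d(π_v W θ)`). [cite: SerreGaloisCohomology1997, I §2.3] -/
theorem twoCocycleClass_localProjection_congr (Z₁ Z₂ : contTwoCocycles (toDGM (ideleBarD K)).toTopRep) (v : Place K)
    (π : HomDual.IdeleProjection K v) (c₁ c₂ : contTwoCocycles (units (Place.Completion v)).toTopRep)
    (hc₁ : ∀ s t : absoluteGaloisGroup (Place.Completion v), c₁.1 (s, t) = (π.toAddMonoidHom.comp (LCarrier.val (ideleBarD K)))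
        (Z₁.1 (absGaloisRestrict K (Place.Completion v) s, absGaloisRestrict K (Place.Completion v) t)))
    (hc₂ : ∀ s t : absoluteGaloisGroup (Place.Completion v), c₂.1 (s, t) = (π.toAddMonoidHom.comp (LCarrier.val (ideleBarD K)))
        (Z₂.1 (absGaloisRestrict K (Place.Completion v) s, absGaloisRestrict K (Place.Completion v) t)))
    (hZ : haveI := absoluteGaloisGroup_compactSpace K; twoCocycleClass _ Z₁ = twoCocycleClass _ Z₂) :
    haveI := absoluteGaloisGroup_compactSpace (Place.Completion v)
    twoCocycleClass _ c₁ = twoCocycleClass _ c₂ := by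
  haveI := absoluteGaloisGroup_compactSpace K
  haveI := absoluteGaloisGroup_compactSpace (Place.Completion v)
  have hπ := ideleProjection_toDGM_smul π
  rw [← sub_eq_zero, ← twoCocycleClass_sub, twoCocycleClass_eq_zero_iff] at hZ ⊢
  obtain ⟨W, hW⟩ := hZ
  refine ⟨⟨fun s => (π.toAddMonoidHom.comp (LCarrier.val (ideleBarD K))) (W (absGaloisRestrict K (Place.Completion v) s)),
    (continuous_of_discreteTopology (f := fun j : LCarrier (ideleBarD K) =>
      (π.toAddMonoidHom.comp (LCarrier.val (ideleBarD K))) j)).comp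
      (W.continuous.comp (absGaloisRestrict K (Place.Completion v)).continuous)⟩, fun s t => ?_⟩
  change c₁.1 (s, t) - c₂.1 (s, t) =
    units (Place.Completion v) s ((π.toAddMonoidHom.comp (LCarrier.val (ideleBarD K))) (W (absGaloisRestrict K (Place.Completion v) t))) -
      (π.toAddMonoidHom.comp (LCarrier.val (ideleBarD K))) (W (absGaloisRestrict K (Place.Completion v) (s * t))) +
      (π.toAddMonoidHom.comp (LCarrier.val (ideleBarD K))) (W (absGaloisRestrict K (Place.Completion v) s))
  rw [hc₁, hc₂, ← map_sub, ← hπ, map_mul, ← map_sub, ← map_add]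
  exact congrArg (π.toAddMonoidHom.comp (LCarrier.val (ideleBarD K)))
    (hW (absGaloisRestrict K (Place.Completion v) s) (absGaloisRestrict K (Place.Completion v) t))

/-! ## §2 The finite-place join: `inv_{K_v} [π_v Z|_v] = (1/n) · inv_v [φ♭ ∪ γ − H♭]` -/

variable {M : Type} [AddCommGroup M] [TopologicalSpace M] [DiscreteTopology M] [Finite M]
variable (ρ : DiscreteGaloisModule K M) (n : ℕ) [NeZero n]

/-- **THE LOCAL JOIN at a finite place `v`.**  Data: a `2`-cocycle `F♭` of `M^D`, a `1`-cocycle `γ` of `M`, a global `2`-cochain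
`H♭` of `μₙ` with `dH♭ = F♭ ∪ γ` for `P = (tateDualPairing ρ n).flip` (S1′'s `hh`), a local `1`-cochain `φ♭` of `M^D|_v` with
`F♭|_v = dφ♭` (S1′'s `hφ`), a local `1`-cochain `λ` of `K̄_vˣ`, a continuous idèle `2`-cocycle `Z` with local projection cocycle
`c_Z(s,t) = π_v Z(θs,θt)`, and the bridge identity `ι_v (κ ((φ♭ ∪ γ − H♭)(σ',τ'))) = π_v Z(θσ',θτ') − dλ(σ',τ')` (conjunct (6♭) of
`exists_bridgePackageMu`).  THEN `inv_{K_v} [c_Z] = zmodToQmodZ n (canonical K n v [φ♭ ∪ γ|_v − H♭|_v])`, the right-hand class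
being S1′'s `cupSubCocycle` local term for `Pv v := P.restrict θ_v`.  Proof: `c_Z − dλ` has the values `ι_v κ (local term)`, so
(D) `twoCocycleClass_push_eq_cohomologyMap` + `brauerInvariantEquiv_cohomologyMap_muLocalIso_kummer`.
[cite: MilneADT2006, I §1, Lemma 4.13, Thm. 4.10 (a) (proof, p. 58)][cite: CasselsFrohlichANT1967, Ch. VII §11.2] -/
theorem brauerInvariantEquiv_localProjection_eq_zmodToQmodZ_canonical (v : HeightOneSpectrum (𝓞 K))
    (Fb : contTwoCocycles (ρ.tateDual n).toTopRep) (γ : contOneCocycles ρ.toTopRep)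
    (Hb : C(absoluteGaloisGroup K × absoluteGaloisGroup K, MuCarrier K n))
    (hHb : haveI := absoluteGaloisGroup_compactSpace K; ∀ σ τ υ : absoluteGaloisGroup K,
      ((tateDualPairing ρ n).flip.cupCocycle₂₁ Fb γ).1 (σ, τ, υ) = dTwo (mu K n).toTopRep Hb σ τ υ)
    (φb : C(absoluteGaloisGroup (Place.Completion (Sum.inr v : Place K)), TateDual K M n))
    (hφb : ∀ σ' τ' : absoluteGaloisGroup (Place.Completion (Sum.inr v : Place K)),
      (resTwo (ρ.tateDual n) (Place.Completion (Sum.inr v : Place K)) Fb).1 (σ', τ') =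
        (DiscreteGaloisModule.toTopRep (GaloisRep.restrictField (Place.Completion (Sum.inr v : Place K)) (ρ.tateDual n))).ρ σ'
          (φb τ') - φb (σ' * τ') + φb σ')
    (lam : C(absoluteGaloisGroup (Place.Completion (Sum.inr v : Place K)), UnitsCarrier (Place.Completion (Sum.inr v : Place K))))
    (Z : contTwoCocycles (toDGM (ideleBarD K)).toTopRep) (π : HomDual.IdeleProjection K (Sum.inr v))
    (cZ : haveI := charZero_adicCompletion v; contTwoCocycles (units (v.adicCompletion K)).toTopRep)
    (hcZ : ∀ s t : absoluteGaloisGroup (v.adicCompletion K), cZ.1 (s, t) = (π.toAddMonoidHom.comp (LCarrier.val (ideleBarD K)))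
        (Z.1 (absGaloisRestrict K (v.adicCompletion K) s, absGaloisRestrict K (v.adicCompletion K) t)))
    (h6 : ∀ σ' τ' : absoluteGaloisGroup (Place.Completion (Sum.inr v : Place K)),
      unitsTransferAddHom K (Place.Completion (Sum.inr v : Place K)) (kummerInclAddHom K n
          ((show MuCarrier K n from
              (φb σ') (ρ (absGaloisRestrict K (Place.Completion (Sum.inr v : Place K)) σ')
                (γ.1 (absGaloisRestrict K (Place.Completion (Sum.inr v : Place K)) τ')))) -
            Hb (absGaloisRestrict K (Place.Completion (Sum.inr v : Place K)) σ',
              absGaloisRestrict K (Place.Completion (Sum.inr v : Place K)) τ'))) =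
        (π.toAddMonoidHom.comp (LCarrier.val (ideleBarD K)))
            (Z.1 (absGaloisRestrict K (Place.Completion (Sum.inr v : Place K)) σ',
              absGaloisRestrict K (Place.Completion (Sum.inr v : Place K)) τ')) -
          (units (Place.Completion (Sum.inr v : Place K)) σ' (lam τ') - lam (σ' * τ') + lam σ')) :
    (haveI := charZero_adicCompletion v; haveI := absoluteGaloisGroup_compactSpace (v.adicCompletion K);
      Prop121vii.brauerInvariantEquiv (v.adicCompletion K) (twoCocycleClass (units (v.adicCompletion K)).toTopRep cZ)) =
      Prop121vii.zmodToQmodZ n (LocalInvariants.canonical K n (Sum.inr v)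
        (haveI := absoluteGaloisGroup_compactSpace K;
         haveI := absoluteGaloisGroup_compactSpace (Place.Completion (Sum.inr v : Place K));
          locClass₂ (mu K n) (Place.Completion (Sum.inr v : Place K))
            ((((tateDualPairing ρ n).flip).restrict (absGaloisRestrict K (Place.Completion (Sum.inr v : Place K)))).cupSubCocycle
              φb (resOne ρ (Place.Completion (Sum.inr v : Place K)) γ)
              (resTwo (ρ.tateDual n) (Place.Completion (Sum.inr v : Place K)) Fb) hφb
              (resCochain₂ (Place.Completion (Sum.inr v : Place K)) Hb)
              (dTwo_resCochain₂_of_cupCocycle₂₁ ((tateDualPairing ρ n).flip)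
                (fun w => ((tateDualPairing ρ n).flip).restrict (absGaloisRestrict K (Place.Completion w)))
                (fun _ _ _ => rfl) Hb hHb (Sum.inr v))))) := by
  haveI : CharZero (v.adicCompletion K) := charZero_adicCompletion v
  haveI := absoluteGaloisGroup_compactSpace K
  haveI := absoluteGaloisGroup_compactSpace (v.adicCompletion K)
  haveI := absoluteGaloisGroup_compactSpace (Place.Completion (Sum.inr v : Place K))
  -- the local term cocycle `z` and the `K̄_vˣ`-cocycle `z' := c_Z − dλ`
  set z := (((tateDualPairing ρ n).flip).restrict (absGaloisRestrict K (Place.Completion (Sum.inr v : Place K)))).cupSubCocycle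
    φb (resOne ρ (Place.Completion (Sum.inr v : Place K)) γ) (resTwo (ρ.tateDual n) (Place.Completion (Sum.inr v : Place K)) Fb) hφb
    (resCochain₂ (Place.Completion (Sum.inr v : Place K)) Hb)
    (dTwo_resCochain₂_of_cupCocycle₂₁ ((tateDualPairing ρ n).flip)
      (fun w => ((tateDualPairing ρ n).flip).restrict (absGaloisRestrict K (Place.Completion w)))
      (fun _ _ _ => rfl) Hb hHb (Sum.inr v)) with hz_def
  let z' : contTwoCocycles (units (v.adicCompletion K)).toTopRep := cZ - (units (v.adicCompletion K)).twoCoboundary lam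
  have hz' : ∀ σ τ : absoluteGaloisGroup (v.adicCompletion K),
      z'.1 (σ, τ) = unitsTransferAddHom K (v.adicCompletion K) (kummerInclAddHom K n (z.1 (σ, τ))) := by
    intro σ τ
    change cZ.1 (σ, τ) - ((units (v.adicCompletion K)).twoCoboundary lam).1 (σ, τ) = _
    rw [hcZ, ContinuousRep.twoCoboundary_apply, hz_def, ContPairing.cupSubCocycle_apply, ContPairing.restrict_toLin,
      ContPairing.flip_toLin_apply]
    exact (h6 σ τ).symm
  have hcl : twoCocycleClass (units (v.adicCompletion K)).toTopRep cZ = twoCocycleClass _ z' := by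
    change _ = twoCocycleClass _ (cZ - (units (v.adicCompletion K)).twoCoboundary lam)
    rw [twoCocycleClass_sub, ContinuousRep.twoCocycleClass_twoCoboundary, sub_zero]
  rw [hcl, twoCocycleClass_push_eq_cohomologyMap v z z' hz', brauerInvariantEquiv_cohomologyMap_muLocalIso_kummer]
  rfl

end Summit.BirchSwinnertonDyer.BirchSwinnertonDyer.Theorems.ShaTwoCochain

end
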